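import Summits.Ventures.YMGap.Thresholds.HaarFourthMomentSUN
import HarnessLib

/-!
# The Haar moments of bidegree `(2,2)` of the entries of `SU(N)`, `N ≥ 3`, continued: `∫ |U₀₀|²|U₁₀|² dU = 1/(N(N+1))` and
# `∫ |U₀₀|²|U₁₁|² dU = 1/(N² − 1)` (row type C-PRESS, `β = 0` inputs, part 19b)

Cell `pub-ymgap`, seat ds-1 (gen 11). HONEST FRAMING: pure compact-group integration for a compact group `G ≅ SU(N)`, `N = 2 + n ≥ 3`;
nothing lattice-specific, nothing about the continuum or the Clay problem. Kernel theorems only, 0 compute, no definitions.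

From part 19a (`∫|U₀₀|⁴ = 2/(N(N+1))`) and two more unitarity sums against `|U₀₀|²`: down column `0` (`Σ_a |U_{a0}|² = 1`, left signed
row swaps fixing row `0`) ★ `∫|U₀₀|²|U₁₀|² = 1/(N(N+1))` (`integral_normSq_mul_normSq_colEntries`), and along row `1`
(`Σ_j |U₁ⱼ|² = 1`, right signed column swaps fixing column `0`) ★ `∫|U₀₀|²|U₁₁|² = 1/(N²−1)` (`integral_normSq_mul_normSq_diag`) —
the remaining moduli entries of the second Weingarten function, and by row orthogonality in mean square the exchange entry
★ `∫ U₀₀U₁₁Ū₀₁Ū₁₀ = −1/((N−1)N(N+1))` (`integral_exchange`) (Creutz (8.22)). Everything here is proved. [folklore]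
-/

noncomputable section

open MeasureTheory Complex
open Literature.MathematicalPhysics.QuantumLattice Literature.MathematicalPhysics.QuantumFieldTheory
open scoped Matrix

namespace Summit.Ventures.YMGap.HaarFourthMomentSUN

open RobustBall.HaarSecondMoments (integral_comp_mul_left integral_comp_mul_right swap_mul_sign_mem)

section Moments

variable {n : ℕ} {G : Type*} [Group G] [TopologicalSpace G] [IsTopologicalGroup G] [CompactSpace G]
  [MeasurableSpace G] [BorelSpace G] (ρ : G →* Matrix (Fin (2 + n)) (Fin (2 + n)) ℂ)

/-! ### Down column `0` and along row `1`: `∫|U₀₀|²|U₁₀|² = 1/(N(N+1))`, `∫|U₀₀|²|U₁₁|² = 1/(N²−1)` -/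

/-- `1 ≠ 0` in `Fin (2+n)`. -/
theorem one_ne_zero_fin : (1 : Fin (2 + n)) ≠ 0 := fun h => by
  have := congrArg Fin.val h; simp [Nat.mod_eq_of_lt (show 1 < 2 + n by omega)] at this

/-- `∫ |ρ₀₀|² |ρ_{a0}|² = ∫ |ρ₀₀|² |ρ₁₀|²` for every row `a ≠ 0` (left signed transposition `1 ↔ a`, fixing row `0`). [folklore] -/
theorem integral_normSq_mul_normSq_rowIdx (hρ : IsSpecialUnitaryModel ρ) {a : Fin (2 + n)} (ha : a ≠ 0) (k : Fin (2 + n)) :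
    ∫ g, Complex.normSq (ρ g 0 0) * Complex.normSq (ρ g a k) ∂haarProbability G =
      ∫ g, Complex.normSq (ρ g 0 0) * Complex.normSq (ρ g 1 k) ∂haarProbability G := by
  rcases eq_or_ne a 1 with rfl | ha1
  · rfl
  set S := Matrix.swap ℂ (1 : Fin (2 + n)) a * Matrix.diagonal (Pi.mulSingle 1 (-1 : ℂ)) with hS
  have hSm : S ∈ Matrix.specialUnitaryGroup (Fin (2 + n)) ℂ := by rw [hS]; exact swap_mul_sign_mem 1 a ha1.symm
  have h := integral_comp_mul_left ρ hρ hSm (fun M => Complex.normSq (M 0 0) * Complex.normSq (M 1 k))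
  have hS1 : ∀ M : Matrix (Fin (2 + n)) (Fin (2 + n)) ℂ, (S * M) 1 k = M a k := fun M => by
    rw [hS, Matrix.mul_assoc, Matrix.swap_mul_apply_left, Matrix.diagonal_mul]
    simp [Pi.mulSingle_eq_of_ne ha1]
  have hS0 : ∀ M : Matrix (Fin (2 + n)) (Fin (2 + n)) ℂ, (S * M) 0 0 = M 0 0 := fun M => by
    rw [hS, Matrix.mul_assoc, Matrix.swap_mul_of_ne one_ne_zero_fin.symm ha.symm, Matrix.diagonal_mul]
    simp [Pi.mulSingle_eq_of_ne (one_ne_zero_fin (n := n)).symm]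
  have hpt : ∀ M : Matrix (Fin (2 + n)) (Fin (2 + n)) ℂ,
      Complex.normSq ((S * M) 0 0) * Complex.normSq ((S * M) 1 k) = Complex.normSq (M 0 0) * Complex.normSq (M a k) :=
    fun M => by rw [hS0, hS1]
  simp only [hpt] at h
  exact h

/-- **Unitarity column sum against `|ρ₀₀|²`**: `∫|ρ₀₀|⁴ + (N−1) ∫|ρ₀₀|²|ρ₁₀|² = 1/N`. [folklore] -/
theorem col_sum_identity (hρ : IsSpecialUnitaryModel ρ) :
    ∫ g, Complex.normSq (ρ g 0 0) ^ 2 ∂haarProbability G +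
        (1 + n : ℝ) * ∫ g, Complex.normSq (ρ g 0 0) * Complex.normSq (ρ g 1 0) ∂haarProbability G = 1 / (2 + n : ℝ) := by
  -- Σ_a |U_{a0}|² = 1 pointwise (U* U = 1)
  have hcol : ∀ g : G, ∑ a, Complex.normSq (ρ g a 0) = 1 := by
    intro g
    have hu := IsSpecialUnitaryModel.mem_unitaryGroup ρ hρ g
    rw [Matrix.mem_unitaryGroup_iff'] at hu
    have h := congrFun (congrFun hu 0) 0
    rw [Matrix.mul_apply, Matrix.one_apply_eq] at h
    have h' : ∑ a, ((Complex.normSq (ρ g a 0) : ℝ) : ℂ) = 1 := by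
      rw [← h]
      refine Finset.sum_congr rfl fun a _ => ?_
      rw [Matrix.star_apply, Complex.star_def, ← Complex.mul_conj, mul_comm]
    exact_mod_cast h'
  have hpt : ∀ g : G, Complex.normSq (ρ g 0 0) = ∑ a, Complex.normSq (ρ g 0 0) * Complex.normSq (ρ g a 0) := by
    intro g; rw [← Finset.mul_sum, hcol g, mul_one]
  have hint : ∀ a ∈ (Finset.univ : Finset (Fin (2 + n))),
      Integrable (fun g => Complex.normSq (ρ g 0 0) * Complex.normSq (ρ g a 0)) (haarProbability G) := fun a _ =>
    integrable_of_continuous' ρ hρ.1 ((continuous_normSq_entry ρ hρ.1 0 0).mul (continuous_normSq_entry ρ hρ.1 a 0))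
  have h1 : ∫ g, Complex.normSq (ρ g 0 0) ∂haarProbability G =
      ∑ a, ∫ g, Complex.normSq (ρ g 0 0) * Complex.normSq (ρ g a 0) ∂haarProbability G := by
    rw [← integral_finsetSum _ hint]
    exact integral_congr_ae (Filter.Eventually.of_forall hpt)
  rw [integral_normSq_entry_real ρ hρ 0 0, ← Finset.add_sum_erase _ _ (Finset.mem_univ (0 : Fin (2 + n)))] at h1
  have hterm : ∀ a ∈ (Finset.univ : Finset (Fin (2 + n))).erase 0,
      ∫ g, Complex.normSq (ρ g 0 0) * Complex.normSq (ρ g a 0) ∂haarProbability G =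
      ∫ g, Complex.normSq (ρ g 0 0) * Complex.normSq (ρ g 1 0) ∂haarProbability G := fun a ha =>
    integral_normSq_mul_normSq_rowIdx ρ hρ (Finset.ne_of_mem_erase ha) 0
  rw [Finset.sum_congr rfl hterm, Finset.sum_const, Finset.card_erase_of_mem (Finset.mem_univ _), Finset.card_univ,
    Fintype.card_fin, nsmul_eq_mul] at h1
  have hsq : ∀ g : G, Complex.normSq (ρ g 0 0) * Complex.normSq (ρ g 0 0) = Complex.normSq (ρ g 0 0) ^ 2 := fun g => by ring
  simp only [hsq] at h1
  have hcast : ((2 + n - 1 : ℕ) : ℝ) = 1 + n := by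
    rw [show 2 + n - 1 = 1 + n by omega]; push_cast; ring
  rw [hcast] at h1
  linarith

/-- ★ **`∫ |ρ(g)₀₀|² |ρ(g)₁₀|² dg = 1/(N(N+1))`** (`N ≥ 3`; same column, different rows). [folklore] -/
theorem integral_normSq_mul_normSq_colEntries (hρ : IsSpecialUnitaryModel ρ) (hn : 1 ≤ n) :
    ∫ g, Complex.normSq (ρ g 0 0) * Complex.normSq (ρ g 1 0) ∂haarProbability G = 1 / ((2 + n : ℝ) * (3 + n)) := by
  have h1 := col_sum_identity ρ hρ
  rw [integral_normSq_sq ρ hρ hn] at h1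
  have hpos : (0 : ℝ) < (2 + n : ℝ) * (3 + n) := by positivity
  have hpos1 : (0 : ℝ) < 1 + n := by positivity
  field_simp at h1
  rw [eq_div_iff hpos.ne']
  nlinarith [h1]

/-- **Unitarity row sum on row `1` against `|ρ₀₀|²`**: `∫|ρ₀₀|²|ρ₁₀|² + (N−1) ∫|ρ₀₀|²|ρ₁₁|² = 1/N`. [folklore] -/
theorem row_one_sum_identity (hρ : IsSpecialUnitaryModel ρ) :
    ∫ g, Complex.normSq (ρ g 0 0) * Complex.normSq (ρ g 1 0) ∂haarProbability G +
        (1 + n : ℝ) * ∫ g, Complex.normSq (ρ g 0 0) * Complex.normSq (ρ g 1 1) ∂haarProbability G = 1 / (2 + n : ℝ) := by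
  have hrow : ∀ g : G, ∑ j, Complex.normSq (ρ g 1 j) = 1 := by
    intro g
    have hu := IsSpecialUnitaryModel.mem_unitaryGroup ρ hρ g
    rw [Matrix.mem_unitaryGroup_iff] at hu
    have h := congrFun (congrFun hu 1) 1
    rw [Matrix.mul_apply, Matrix.one_apply_eq] at h
    have h' : ∑ j, ((Complex.normSq (ρ g 1 j) : ℝ) : ℂ) = 1 := by
      rw [← h]
      refine Finset.sum_congr rfl fun j _ => ?_
      rw [Matrix.star_apply, Complex.star_def, Complex.mul_conj]
    exact_mod_cast h'
  have hpt : ∀ g : G, Complex.normSq (ρ g 0 0) = ∑ j, Complex.normSq (ρ g 0 0) * Complex.normSq (ρ g 1 j) := by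
    intro g; rw [← Finset.mul_sum, hrow g, mul_one]
  have hint : ∀ j ∈ (Finset.univ : Finset (Fin (2 + n))),
      Integrable (fun g => Complex.normSq (ρ g 0 0) * Complex.normSq (ρ g 1 j)) (haarProbability G) := fun j _ =>
    integrable_of_continuous' ρ hρ.1 ((continuous_normSq_entry ρ hρ.1 0 0).mul (continuous_normSq_entry ρ hρ.1 1 j))
  have h1 : ∫ g, Complex.normSq (ρ g 0 0) ∂haarProbability G =
      ∑ j, ∫ g, Complex.normSq (ρ g 0 0) * Complex.normSq (ρ g 1 j) ∂haarProbability G := by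
    rw [← integral_finsetSum _ hint]
    exact integral_congr_ae (Filter.Eventually.of_forall hpt)
  -- the terms j ≠ 0 all equal the j = 1 term (right signed swaps fixing column 0)
  have hterm : ∀ j ∈ (Finset.univ : Finset (Fin (2 + n))).erase 0,
      ∫ g, Complex.normSq (ρ g 0 0) * Complex.normSq (ρ g 1 j) ∂haarProbability G =
      ∫ g, Complex.normSq (ρ g 0 0) * Complex.normSq (ρ g 1 1) ∂haarProbability G := by
    intro j hj
    have hj0 : j ≠ 0 := Finset.ne_of_mem_erase hj
    rcases eq_or_ne j 1 with rfl | hj1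
    · rfl
    set T := Matrix.swap ℂ (1 : Fin (2 + n)) j * Matrix.diagonal (Pi.mulSingle 1 (-1 : ℂ)) with hT
    have hTm : T ∈ Matrix.specialUnitaryGroup (Fin (2 + n)) ℂ := by rw [hT]; exact swap_mul_sign_mem 1 j hj1.symm
    have h := integral_comp_mul_right ρ hρ hTm (fun M => Complex.normSq (M 0 0) * Complex.normSq (M 1 1))
    have hT1 : ∀ M : Matrix (Fin (2 + n)) (Fin (2 + n)) ℂ, (M * T) 1 1 = -M 1 j := fun M => by
      rw [hT, ← Matrix.mul_assoc, Matrix.mul_diagonal, Matrix.mul_swap_apply_left]; simp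
    have hT0 : ∀ M : Matrix (Fin (2 + n)) (Fin (2 + n)) ℂ, (M * T) 0 0 = M 0 0 := fun M => by
      rw [hT, ← Matrix.mul_assoc, Matrix.mul_diagonal, Matrix.mul_swap_of_ne one_ne_zero_fin.symm hj0.symm]
      simp [Pi.mulSingle_eq_of_ne (one_ne_zero_fin (n := n)).symm]
    have hpt' : ∀ M : Matrix (Fin (2 + n)) (Fin (2 + n)) ℂ,
        Complex.normSq ((M * T) 0 0) * Complex.normSq ((M * T) 1 1) = Complex.normSq (M 0 0) * Complex.normSq (M 1 j) :=
      fun M => by rw [hT0, hT1, Complex.normSq_neg]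
    simp only [hpt'] at h
    exact h
  rw [integral_normSq_entry_real ρ hρ 0 0, ← Finset.add_sum_erase _ _ (Finset.mem_univ (0 : Fin (2 + n))),
    Finset.sum_congr rfl hterm, Finset.sum_const, Finset.card_erase_of_mem (Finset.mem_univ _), Finset.card_univ,
    Fintype.card_fin, nsmul_eq_mul] at h1
  have hcast : ((2 + n - 1 : ℕ) : ℝ) = 1 + n := by
    rw [show 2 + n - 1 = 1 + n by omega]; push_cast; ring
  rw [hcast] at h1
  linarith

/-- ★ **`∫ |ρ(g)₀₀|² |ρ(g)₁₁|² dg = 1/(N² − 1)`** (`N ≥ 3`; different rows and columns). [folklore] -/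
theorem integral_normSq_mul_normSq_diag (hρ : IsSpecialUnitaryModel ρ) (hn : 1 ≤ n) :
    ∫ g, Complex.normSq (ρ g 0 0) * Complex.normSq (ρ g 1 1) ∂haarProbability G = 1 / ((1 + n : ℝ) * (3 + n)) := by
  have h1 := row_one_sum_identity ρ hρ
  rw [integral_normSq_mul_normSq_colEntries ρ hρ hn] at h1
  have hpos : (0 : ℝ) < (1 + n : ℝ) * (3 + n) := by positivity
  have hpos2 : (0 : ℝ) < (2 + n : ℝ) := by positivity
  field_simp at h1
  rw [eq_div_iff hpos.ne']
  nlinarith [h1]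

/-! ### The exchange entry: `∫ U₀₀ U₁₁ conj(U₀₁) conj(U₁₀) = −1/((N−1)N(N+1))` (row orthogonality) -/

/-- Local shorthand: the exchange monomial `X_{j,k} = U₀ⱼ conj(U₁ⱼ) conj(U₀ₖ) U₁ₖ`. -/
local notation3 (prettyPrint := false) "𝔵" M:max j:max k:max =>
  M 0 j * (starRingEnd ℂ) (M 1 j) * (starRingEnd ℂ) (M 0 k) * M 1 k

/-- Integrability of the exchange monomials. [folklore] -/
theorem integrable_exchange (hρ : Continuous ρ) (j k : Fin (2 + n)) :
    Integrable (fun g => 𝔵 (ρ g) j k) (haarProbability G) :=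
  ((((hρ.matrix_elem 0 j).mul (Complex.continuous_conj.comp (hρ.matrix_elem 1 j))).mul
    (Complex.continuous_conj.comp (hρ.matrix_elem 0 k))).mul (hρ.matrix_elem 1 k)).integrable_of_hasCompactSupport
    (HasCompactSupport.of_compactSpace _)

/-- A right signed transposition `(a b)` permutes the column indices of the exchange monomial (the signs cancel: every column index occurs
once plain and once conjugated in each row pair). [folklore] -/
theorem integral_exchange_swap (hρ : IsSpecialUnitaryModel ρ) {a b : Fin (2 + n)} (hab : a ≠ b) (j k : Fin (2 + n)) :
    ∫ g, 𝔵 (ρ g) j k ∂haarProbability G = ∫ g, 𝔵 (ρ g) (Equiv.swap a b j) (Equiv.swap a b k) ∂haarProbability G := by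
  set T : Matrix (Fin (2 + n)) (Fin (2 + n)) ℂ := Matrix.swap ℂ a b * Matrix.diagonal (Pi.mulSingle a (-1 : ℂ)) with hT
  have hTm : T ∈ Matrix.specialUnitaryGroup (Fin (2 + n)) ℂ := by rw [hT]; exact swap_mul_sign_mem a b hab
  -- (M T)_{r c} = ε_c · M_{r, σ c} with ε_c ∈ {±1} independent of the row r
  have hcol : ∀ c : Fin (2 + n), ∃ ε : ℂ, ε * ε = 1 ∧ (starRingEnd ℂ) ε = ε ∧
      ∀ (X : Matrix (Fin (2 + n)) (Fin (2 + n)) ℂ) (r : Fin (2 + n)), (X * T) r c = ε * X r (Equiv.swap a b c) := by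
    intro c
    by_cases hca : c = a
    · refine ⟨-1, by norm_num, by simp, fun X r => ?_⟩
      rw [hca, hT, ← Matrix.mul_assoc, Matrix.mul_diagonal, Matrix.mul_swap_apply_left, Equiv.swap_apply_left]; simp
    · by_cases hcb : c = b
      · refine ⟨1, by norm_num, by simp, fun X r => ?_⟩
        rw [hcb, hT, ← Matrix.mul_assoc, Matrix.mul_diagonal, Matrix.mul_swap_apply_right, Equiv.swap_apply_right]
        simp [Pi.mulSingle_eq_of_ne (Ne.symm hab)]
      · refine ⟨1, by norm_num, by simp, fun X r => ?_⟩
        rw [hT, ← Matrix.mul_assoc, Matrix.mul_diagonal, Matrix.mul_swap_of_ne hca hcb, Equiv.swap_apply_of_ne_of_ne hca hcb]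
        simp [Pi.mulSingle_eq_of_ne hca]
  obtain ⟨εj, hεj, hεj', ej⟩ := hcol j
  obtain ⟨εk, hεk, hεk', ek⟩ := hcol k
  have h := integral_comp_mul_right ρ hρ hTm (fun M => 𝔵 M j k)
  have hpt : ∀ M : Matrix (Fin (2 + n)) (Fin (2 + n)) ℂ, 𝔵 (M * T) j k = 𝔵 M (Equiv.swap a b j) (Equiv.swap a b k) := by
    intro M
    rw [ej M 0, ej M 1, ek M 0, ek M 1, map_mul, map_mul, hεj', hεk']
    linear_combination (M 0 (Equiv.swap a b j) * (starRingEnd ℂ) (M 1 (Equiv.swap a b j)) * (starRingEnd ℂ) (M 0 (Equiv.swap a b k)) *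
      M 1 (Equiv.swap a b k)) * (εk * εk * hεj + hεk)
  simp only [hpt] at h
  exact h.symm

/-- Every off-diagonal exchange integral equals the `(0,1)` one. [folklore] -/
theorem integral_exchange_eq (hρ : IsSpecialUnitaryModel ρ) {j k : Fin (2 + n)} (hjk : j ≠ k) :
    ∫ g, 𝔵 (ρ g) j k ∂haarProbability G = ∫ g, 𝔵 (ρ g) 0 1 ∂haarProbability G := by
  have h10 : (1 : Fin (2 + n)) ≠ 0 := one_ne_zero_fin
  -- step 1: move j to 0
  have step1 : ∃ k' : Fin (2 + n), k' ≠ 0 ∧ ∫ g, 𝔵 (ρ g) j k ∂haarProbability G = ∫ g, 𝔵 (ρ g) 0 k' ∂haarProbability G := by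
    rcases eq_or_ne j 0 with rfl | hj0
    · exact ⟨k, hjk.symm, rfl⟩
    refine ⟨Equiv.swap 0 j k, ?_, ?_⟩
    · intro h0
      exact hjk ((Equiv.swap (0 : Fin (2 + n)) j).injective (h0.trans (Equiv.swap_apply_right 0 j).symm)).symm
    · rw [integral_exchange_swap ρ hρ hj0.symm j k, Equiv.swap_apply_right]
  obtain ⟨k', hk', e⟩ := step1
  rw [e]
  rcases eq_or_ne k' 1 with rfl | hk1
  · rfl
  rw [integral_exchange_swap ρ hρ hk1.symm 0 k', Equiv.swap_apply_of_ne_of_ne h10.symm hk'.symm, Equiv.swap_apply_right]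

/-- The diagonal exchange integral is `∫ |U₀ⱼ|²|U₁ⱼ|² = ∫ |U₀₀|²|U₁₀|²`. [folklore] -/
theorem integral_exchange_diag (hρ : IsSpecialUnitaryModel ρ) (j : Fin (2 + n)) :
    ∫ g, 𝔵 (ρ g) j j ∂haarProbability G = ((∫ g, Complex.normSq (ρ g 0 0) * Complex.normSq (ρ g 1 0) ∂haarProbability G : ℝ) : ℂ) := by
  have hj : ∫ g, 𝔵 (ρ g) j j ∂haarProbability G = ∫ g, 𝔵 (ρ g) 0 0 ∂haarProbability G := by
    rcases eq_or_ne j 0 with rfl | hj0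
    · rfl
    rw [integral_exchange_swap ρ hρ hj0.symm j j, Equiv.swap_apply_right]
  rw [hj, ← integral_complex_ofReal]
  refine integral_congr_ae (Filter.Eventually.of_forall fun g => ?_)
  push_cast
  rw [← Complex.mul_conj, ← Complex.mul_conj]
  ring

/-- **Row orthogonality in mean square**: `Σ_{j,k} ∫ 𝔵_{j,k} = ∫ |Σ_j U₀ⱼ conj(U₁ⱼ)|² = 0`. [folklore] -/
theorem sum_integral_exchange_eq_zero (hρ : IsSpecialUnitaryModel ρ) :
    ∑ j, ∑ k, ∫ g, 𝔵 (ρ g) j k ∂haarProbability G = 0 := by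
  have horth : ∀ g : G, ∑ j, ρ g 0 j * (starRingEnd ℂ) (ρ g 1 j) = 0 := by
    intro g
    have hu := IsSpecialUnitaryModel.mem_unitaryGroup ρ hρ g
    rw [Matrix.mem_unitaryGroup_iff] at hu
    have h := congrFun (congrFun hu 0) 1
    rw [Matrix.mul_apply, Matrix.one_apply_ne one_ne_zero_fin.symm] at h
    simpa [Matrix.star_apply] using h
  have hpt : ∀ g : G, ∑ j, ∑ k, 𝔵 (ρ g) j k = 0 := by
    intro g
    have h := horth g
    have h' : (starRingEnd ℂ) (∑ k, ρ g 0 k * (starRingEnd ℂ) (ρ g 1 k)) = 0 := by rw [h, map_zero]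
    rw [map_sum] at h'
    calc ∑ j, ∑ k, 𝔵 (ρ g) j k
        = (∑ j, ρ g 0 j * (starRingEnd ℂ) (ρ g 1 j)) * ∑ k, (starRingEnd ℂ) (ρ g 0 k * (starRingEnd ℂ) (ρ g 1 k)) := by
          rw [Finset.sum_mul_sum]
          refine Finset.sum_congr rfl fun j _ => Finset.sum_congr rfl fun k _ => ?_
          rw [map_mul, Complex.conj_conj]; ring
      _ = 0 := by rw [h, zero_mul]
  have hin : ∀ j : Fin (2 + n), ∑ k, ∫ g, 𝔵 (ρ g) j k ∂haarProbability G = ∫ g, ∑ k, 𝔵 (ρ g) j k ∂haarProbability G :=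
    fun j => (integral_finsetSum _ (fun k _ => integrable_exchange ρ hρ.1 j k)).symm
  simp_rw [hin]
  rw [← integral_finsetSum _ (fun j _ => integrable_finsetSum _ fun k _ => integrable_exchange ρ hρ.1 j k)]
  simp_rw [hpt, integral_zero]

/-- ★ **`∫ U₀₀ U₁₁ conj(U₀₁) conj(U₁₀) dU = −1/((N−1)N(N+1))`** for `G ≅ SU(N)`, `N ≥ 3` — the exchange (sign-carrying) entry of the
second Weingarten function (Creutz (8.22)). [folklore] -/
theorem integral_exchange (hρ : IsSpecialUnitaryModel ρ) (hn : 1 ≤ n) :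
    ∫ g, ρ g 0 0 * ρ g 1 1 * (starRingEnd ℂ) (ρ g 0 1) * (starRingEnd ℂ) (ρ g 1 0) ∂haarProbability G =
      -1 / ((1 + n : ℂ) * (2 + n) * (3 + n)) := by
  -- ∫ U₀₀U₁₁Ū₀₁Ū₁₀ = ∫ 𝔵_{0,1}... careful: 𝔵 M 0 1 = M₀₀ conj(M₁₀) conj(M₀₁) M₁₁ — the same product
  have hx : ∀ g : G, ρ g 0 0 * ρ g 1 1 * (starRingEnd ℂ) (ρ g 0 1) * (starRingEnd ℂ) (ρ g 1 0) = 𝔵 (ρ g) 0 1 := fun g => by ring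
  simp_rw [hx]
  have hsum := sum_integral_exchange_eq_zero ρ hρ
  -- split the double sum into diagonal (N terms, each E) and off-diagonal (N(N−1) terms, each D)
  have hE := integral_normSq_mul_normSq_colEntries ρ hρ hn
  have hinner : ∀ j : Fin (2 + n), ∑ k, ∫ g, 𝔵 (ρ g) j k ∂haarProbability G =
      ((∫ g, Complex.normSq (ρ g 0 0) * Complex.normSq (ρ g 1 0) ∂haarProbability G : ℝ) : ℂ) +
        (1 + n : ℂ) * ∫ g, 𝔵 (ρ g) 0 1 ∂haarProbability G := by
    intro j
    rw [← Finset.add_sum_erase _ _ (Finset.mem_univ j), integral_exchange_diag ρ hρ j]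
    congr 1
    rw [Finset.sum_congr rfl (fun k hk => integral_exchange_eq ρ hρ (Finset.ne_of_mem_erase hk).symm), Finset.sum_const,
      Finset.card_erase_of_mem (Finset.mem_univ _), Finset.card_univ, Fintype.card_fin, nsmul_eq_mul]
    congr 1
    rw [show 2 + n - 1 = 1 + n by omega]; push_cast; ring
  simp_rw [hinner] at hsum
  rw [Finset.sum_const, Finset.card_univ, Fintype.card_fin, nsmul_eq_mul, hE] at hsum
  have h1 : (1 + n : ℂ) ≠ 0 := by exact_mod_cast (show (1 + n : ℕ) ≠ 0 by omega)
  have h2 : (2 + n : ℂ) ≠ 0 := by exact_mod_cast (show (2 + n : ℕ) ≠ 0 by omega)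
  have h3 : (3 + n : ℂ) ≠ 0 := by exact_mod_cast (show (3 + n : ℕ) ≠ 0 by omega)
  push_cast at hsum
  rw [eq_div_iff (mul_ne_zero (mul_ne_zero h1 h2) h3)]
  field_simp at hsum
  linear_combination hsum

end Moments

end Summit.Ventures.YMGap.HaarFourthMomentSUN
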